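import HarnessLib
import Summits.RiemannHypothesis.RiemannHypothesis.Theorems.SignConePointwiseSOSTail

/-!
# Route SignCone: the Dirichlet-SOS tail bound

Support for the unconditional rungs of `SignConeOscillatory` / `SignConeInequality`
(items stmt-RiemannHypothesis-16302 / 16301). From the data and class expansion of
`SignConePointwiseSOSTail.lean`: the comb is the in-class part of `acoef` (`sum_inClasses_acoef`), and

  `Σ_n a_n cos(y log n) − Hsos(y) ≤ sosBound`  for every real `y`  (`comb_sub_Hsos_le`),

because `comb − H = Σ_in (a/2 + C/4^S) cos − (squares)/4^S ≤ Σ_in |a/2 + C/4^S|`; and every frequency of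
`Hsos` satisfies `L < |log p − log q|` (`Hsos_frequencies`), so `Hsos` pairs to zero with autocorrelations
supported in `[−L, L]`.
-/

noncomputable section

-- `Summit.RiemannHypothesis.RiemannHypothesis.…` repeats a namespace component by design (D-0017 layout).
set_option linter.dupNamespace false

open Real Finset

namespace Summit.RiemannHypothesis.RiemannHypothesis.Theorems.SignCone

open Literature.Analysis.ValidatedNumerics.Numerics Literature.NumberTheory.LFunctions

namespace SOSData

variable {Z : SOSData}

/-- The comb, read off the in-classes: `Σ_in (a_{pq}/2) cos(y(log p − log q)) = Σ_n a_n cos(y log n)`. [folklore] -/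
theorem sum_inClasses_acoef {nodes : List ℕ} {L : ℚ} (h : Z.checkSOS nodes L = true)
    (a : ℕ → ℚ) (y : ℝ) :
    ∑ pq ∈ Z.inClasses, (acoef nodes a pq.1 pq.2 : ℝ) / 2 * Real.cos (y * (Real.log pq.1 - Real.log pq.2)) =
      ∑ n ∈ nodes.toFinset, (a n : ℝ) * Real.cos (y * Real.log n) := by
  classical
  obtain ⟨hall, -, -⟩ := checkSOS_spec h
  have hall' : ∀ n ∈ nodes.toFinset, 2 ≤ n ∧ n ≤ Z.Np ∧ Z.isOut n 1 = false :=
    fun n hn => hall n (List.mem_toFinset.1 hn)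
  set img1 := nodes.toFinset.image fun n => (n, 1) with himg1
  set img2 := nodes.toFinset.image fun n => (1, n) with himg2
  -- both images lie in the in-classes
  have hsub1 : img1 ⊆ Z.inClasses := by
    intro pq hpq
    rw [himg1, Finset.mem_image] at hpq
    obtain ⟨n, hn, rfl⟩ := hpq
    obtain ⟨h2, hN, hout⟩ := hall' n hn
    simp only [inClasses, ratioClasses, Finset.mem_filter, Finset.mem_product, Finset.mem_Icc]
    exact ⟨⟨⟨⟨by omega, hN⟩, le_rfl, by omega⟩, Nat.coprime_one_right n⟩, hout⟩
  have hsub2 : img2 ⊆ Z.inClasses := by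
    intro pq hpq
    rw [himg2, Finset.mem_image] at hpq
    obtain ⟨n, hn, rfl⟩ := hpq
    obtain ⟨h2, hN, hout⟩ := hall' n hn
    simp only [inClasses, ratioClasses, Finset.mem_filter, Finset.mem_product, Finset.mem_Icc]
    refine ⟨⟨⟨⟨le_rfl, by omega⟩, by omega, hN⟩, Nat.coprime_one_left n⟩, ?_⟩
    rw [isOut_comm]; exact hout
  have hdisj : Disjoint img1 img2 := by
    rw [Finset.disjoint_left]
    intro pq h1 h2
    rw [himg1, Finset.mem_image] at h1
    rw [himg2, Finset.mem_image] at h2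
    obtain ⟨n, hn, rfl⟩ := h1
    obtain ⟨m, hm, he⟩ := h2
    simp only [Prod.mk.injEq] at he
    have := (hall' n hn).1
    omega
  -- outside the images the coefficient vanishes
  have hzero : ∀ pq ∈ Z.inClasses, pq ∉ img1 ∪ img2 →
      (acoef nodes a pq.1 pq.2 : ℝ) / 2 * Real.cos (y * (Real.log pq.1 - Real.log pq.2)) = 0 := by
    intro pq _ hn
    have : acoef nodes a pq.1 pq.2 = 0 := by
      unfold acoef
      split_ifs with h1 h2
      · exfalso; apply hn
        rw [Finset.mem_union]; left
        rw [himg1, Finset.mem_image]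
        exact ⟨pq.1, List.mem_toFinset.2 h1.2, by rcases pq with ⟨p, q⟩; simp_all⟩
      · exfalso; apply hn
        rw [Finset.mem_union]; right
        rw [himg2, Finset.mem_image]
        exact ⟨pq.2, List.mem_toFinset.2 h2.2, by rcases pq with ⟨p, q⟩; simp_all⟩
      · rfl
    rw [this]; push_cast; ring
  rw [← Finset.sum_subset (Finset.union_subset hsub1 hsub2) hzero, Finset.sum_union hdisj]
  -- evaluate on the images
  have hinj1 : Set.InjOn (fun n : ℕ => (n, 1)) ↑nodes.toFinset := fun a _ b _ h => by
    simpa using h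
  have hinj2 : Set.InjOn (fun n : ℕ => ((1 : ℕ), n)) ↑nodes.toFinset := fun a _ b _ h => by
    simpa using h
  rw [himg1, himg2, Finset.sum_image hinj1, Finset.sum_image hinj2, ← Finset.sum_add_distrib]
  refine Finset.sum_congr rfl fun n hn => ?_
  obtain ⟨h2, -, -⟩ := hall' n hn
  have hmem : n ∈ nodes := List.mem_toFinset.1 hn
  have h1 : acoef nodes a n 1 = a n := by
    unfold acoef; rw [if_pos ⟨rfl, hmem⟩]
  have h2' : acoef nodes a 1 n = a n := by
    unfold acoef
    rw [if_neg (by rintro ⟨h, -⟩; omega), if_pos ⟨rfl, hmem⟩]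
  simp only [h1, h2', Nat.cast_one, Real.log_one, sub_zero, zero_sub, mul_neg, Real.cos_neg]
  ring

/-- **The Dirichlet-SOS tail bound**: for every real `y`,
`Σ_n a_n cos(y log n) − H(y) ≤ M` with `H = Hsos` and `M = sosBound`. [folklore] -/
theorem comb_sub_Hsos_le {nodes : List ℕ} {a : ℕ → ℚ} {L : ℚ} (h : Z.checkSOS nodes L = true)
    (hnd : nodes.Nodup) (y : ℝ) :
    (nodes.map fun n => (a n : ℝ) * Real.cos (y * Real.log n)).sum - Z.Hsos y ≤ (Z.sosBound nodes a : ℝ) := by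
  classical
  set cosr : ℕ × ℕ → ℝ := fun pq => Real.cos (y * (Real.log pq.1 - Real.log pq.2)) with hcosr
  have hSQ := Z.classSum_expansion_nonneg y
  -- split the squares into out / in
  rw [← Finset.sum_filter_add_sum_filter_not (ratioClasses Z.Np) (fun pq => Z.isOut pq.1 pq.2 = true)] at hSQ
  have hnot : (ratioClasses Z.Np).filter (fun pq => ¬ Z.isOut pq.1 pq.2 = true) = Z.inClasses := by
    unfold inClasses; congr 1; ext pq; simp
  rw [hnot] at hSQ
  -- H as the out-part
  have hH : Z.Hsos y = ∑ pq ∈ (ratioClasses Z.Np).filter (fun pq => Z.isOut pq.1 pq.2 = true),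
      ((Z.classSum pq.1 pq.2 : ℝ) / 4 ^ Z.S) * cosr pq := by
    unfold Hsos
    rw [Finset.sum_filter]
    refine Finset.sum_congr rfl fun pq _ => ?_
    split_ifs <;> push_cast <;> simp [hcosr]
  have hH' : Z.Hsos y * 4 ^ Z.S = ∑ pq ∈ (ratioClasses Z.Np).filter (fun pq => Z.isOut pq.1 pq.2 = true),
      (Z.classSum pq.1 pq.2 : ℝ) * cosr pq := by
    rw [hH, Finset.sum_mul]
    refine Finset.sum_congr rfl fun pq _ => ?_
    have : (4 : ℝ) ^ Z.S ≠ 0 := pow_ne_zero _ (by norm_num)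
    field_simp
  -- the comb as the in-part of acoef
  have hcomb : (nodes.map fun n => (a n : ℝ) * Real.cos (y * Real.log n)).sum =
      ∑ pq ∈ Z.inClasses, (acoef nodes a pq.1 pq.2 : ℝ) / 2 * cosr pq := by
    rw [← List.sum_toFinset _ hnd, sum_inClasses_acoef h a y]
  -- the bound as the in-sum of absolute values
  have hB : (Z.sosBound nodes a : ℝ) =
      ∑ pq ∈ Z.inClasses, |(Z.classSum pq.1 pq.2 : ℝ) / 4 ^ Z.S + (acoef nodes a pq.1 pq.2 : ℝ) / 2| := by
    unfold sosBound inClasses ratioClasses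
    rw [Finset.filter_filter, Finset.sum_filter, Finset.sum_product, sumR_eq_sum,
      ← Finset.Ico_add_one_right_eq_Icc, Finset.sum_Ico_eq_sum_range]
    push_cast
    refine Finset.sum_congr (by simp) fun p' _ => ?_
    rw [sumR_eq_sum, Finset.sum_Ico_eq_sum_range]
    push_cast
    refine Finset.sum_congr (by simp) fun q' _ => ?_
    rw [Nat.add_comm 1 p', Nat.add_comm 1 q']
    by_cases hc : Nat.Coprime (p' + 1) (q' + 1) ∧ Z.isOut (p' + 1) (q' + 1) = false
    · rw [if_pos hc, if_pos hc]; push_cast; ring_nf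
    · rw [if_neg hc, if_neg hc]; push_cast; rfl
  -- assemble
  have h4 : (0 : ℝ) < 4 ^ Z.S := pow_pos (by norm_num) _
  have key : (nodes.map fun n => (a n : ℝ) * Real.cos (y * Real.log n)).sum - Z.Hsos y ≤
      ∑ pq ∈ Z.inClasses, ((acoef nodes a pq.1 pq.2 : ℝ) / 2 + (Z.classSum pq.1 pq.2 : ℝ) / 4 ^ Z.S) * cosr pq := by
    have hin : ∑ pq ∈ Z.inClasses, ((acoef nodes a pq.1 pq.2 : ℝ) / 2 + (Z.classSum pq.1 pq.2 : ℝ) / 4 ^ Z.S) * cosr pq =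
        ∑ pq ∈ Z.inClasses, (acoef nodes a pq.1 pq.2 : ℝ) / 2 * cosr pq +
          (∑ pq ∈ Z.inClasses, (Z.classSum pq.1 pq.2 : ℝ) * cosr pq) / 4 ^ Z.S := by
      rw [Finset.sum_div, ← Finset.sum_add_distrib]
      refine Finset.sum_congr rfl fun pq _ => ?_
      ring
    rw [hin, hcomb]
    have hneg : -Z.Hsos y ≤ (∑ pq ∈ Z.inClasses, (Z.classSum pq.1 pq.2 : ℝ) * cosr pq) / 4 ^ Z.S := by
      rw [le_div_iff₀ h4, neg_mul, hH']
      linarith [hSQ]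
    linarith
  refine key.trans ?_
  rw [hB]
  refine Finset.sum_le_sum fun pq _ => ?_
  have hc : |cosr pq| ≤ 1 := Real.abs_cos_le_one _
  calc ((acoef nodes a pq.1 pq.2 : ℝ) / 2 + (Z.classSum pq.1 pq.2 : ℝ) / 4 ^ Z.S) * cosr pq
      ≤ |((acoef nodes a pq.1 pq.2 : ℝ) / 2 + (Z.classSum pq.1 pq.2 : ℝ) / 4 ^ Z.S) * cosr pq| := le_abs_self _
    _ = |(acoef nodes a pq.1 pq.2 : ℝ) / 2 + (Z.classSum pq.1 pq.2 : ℝ) / 4 ^ Z.S| * |cosr pq| := abs_mul _ _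
    _ ≤ |(acoef nodes a pq.1 pq.2 : ℝ) / 2 + (Z.classSum pq.1 pq.2 : ℝ) / 4 ^ Z.S| * 1 :=
        mul_le_mul_of_nonneg_left hc (abs_nonneg _)
    _ = |(Z.classSum pq.1 pq.2 : ℝ) / 4 ^ Z.S + (acoef nodes a pq.1 pq.2 : ℝ) / 2| := by
        rw [mul_one, add_comm]

/-- **The frequencies of `H` lie outside the window**: every out-class `(p, q)` of the basis has
`L < |log p − log q|`. [folklore] -/
theorem Hsos_frequencies {nodes : List ℕ} {L : ℚ} (h : Z.checkSOS nodes L = true) {pq : ℕ × ℕ}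
    (hpq : pq ∈ ratioClasses Z.Np) (hout : Z.isOut pq.1 pq.2 = true) :
    (L : ℝ) < |Real.log pq.1 - Real.log pq.2| := by
  obtain ⟨-, hT, hexp⟩ := checkSOS_spec h
  simp only [ratioClasses, Finset.mem_filter, Finset.mem_product, Finset.mem_Icc] at hpq
  exact lt_abs_log_sub_of_isOut hT hexp hpq.1.1.1 hpq.1.2.1 hout

end SOSData

end Summit.RiemannHypothesis.RiemannHypothesis.Theorems.SignCone

end
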